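import Literature.IUT.LogVolume.TorsionPointsFacts
import HarnessLib

/-!
# [IUTchIV] Proposition 1.8 (iii) over the interface: `ρ₂` factors through `G_E` as soon as it kills
# `Aut_k̄(E_k̄)` — proof over `Prop18.TorsionSetting`

`Proofs` companion (theorems only; no definitions, no named facts, no instances) of
`Literature.IUT.LogVolume.TorsionPointsFacts` (abc-iut-S2), which types S. Mochizuki,
*Inter-universal Teichmüller theory IV* (kurims Apr-2020 manuscript), Prop. 1.8 (i)–(vii) pp. 18–19 as
named `Prop`s `P18_i, …, P18_vii` over the interface `Prop18.TorsionSetting`; sequel of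
`TorsionPointsFactsProofs` (abc-iut-L5-t12: (iv) from (i) and (ii)). Written by the cell `abc-iut`
(seat abc-iut-w5-d047), DAG node `IUTchIV:Prop1.8(iii)`.

The printed proof of (iii) (p. 20) is one sentence inside the interface:

> "Assertion (iii) follows immediately from the fact that, in the situation of (iii),
> `Aut_k̄(E_k̄) = {±1}` acts trivially on `E_k̄[2]`."

i.e. `ρ₂ : Aut_k(E_k̄) → Aut(E_k̄[2])` kills `Aut_k̄(E_k̄) = Ker(Aut_k(E_k̄) → G_k)` (exactness, part of
(ii)), hence factors through the image `G_E`. Over the typed interface the action of `Aut_k̄(E_k̄)` on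
`E_k̄[2]` is the composite `ρ 2 ∘ incl` of two FREE fields, so the honest kernel form is:

* `TorsionSetting.exists_factor_of_ker_le` — for ANY level `n`: if `Ker(proj) ⊆ Im(incl)` and
  `ρ_n ∘ incl = 1`, then `ρ_n` factors through `G_E ⊆ G_k` (pure group theory: lift along the
  surjection `Aut_k(E_k̄) ↠ G_E`);
* `TorsionSetting.p18_iii_of_ker_le_range` — **(iii) AS TYPED** from the exactness clause of (ii) and
  "`Aut_k̄(E_k̄)` acts trivially on `E_k̄[2]`"; `p18_iii_of_p18_ii` — the same from `P18_ii`;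
* `TorsionSetting.rho_incl_eq_one_of_exists_factor` — conversely a factorisation through `G_E` forces
  `ρ₂ ∘ incl = 1` (given `Im(incl) ⊆ Ker(proj)`), so under (ii)'s exactness the conclusion of (iii) is
  EQUIVALENT to that triviality (`p18_iii_conclusion_iff`): the hypothesis is the exact residual content.

The REAL form of that residual content for Weierstrass curves ("`[-1]`, and hence `Aut_K(E) = {±1}`, acts
trivially on `E[2]`; two semi-linear automorphisms over the same `σ ∈ G_k` induce the same map on
`E[2]`") is proved in `Literature.NumberTheory.EllipticCurves.WeierstrassFieldOfModuliProofs`.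
Nothing here takes a side on [IUTchIII] Cor. 3.12; Prop. 1.8 is classical ("well-known elementary
facts", p. 18).

## References

* [Mochizuki2012] S. Mochizuki, IUT IV, Prop. 1.8 (ii), (iii) pp. 18–19; proof of (iii) p. 20.
* [SilvermanAEC2009] J. H. Silverman, *The Arithmetic of Elliptic Curves*, 2nd ed., III.10.1.
-/

namespace Literature.IUT.LogVolume

namespace Prop18

namespace TorsionSetting

variable (S : TorsionSetting)

/-- **Lifting `ρ_n` along `Aut_k(E_k̄) ↠ G_E`.** If `Ker(Aut_k(E_k̄) → G_k) ⊆ Aut_k̄(E_k̄)` (exactness,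
part of [IUTchIV] Prop. 1.8 (ii)) and `ρ_n` kills `Aut_k̄(E_k̄)`, then `ρ_n` factors through the image
`G_E ⊆ G_k`: there is a homomorphism `ρ̄ : G_E → End(E_k̄[n])` with `ρ_n = ρ̄ ∘ proj`. Pure group
theory (the values of `ρ_n` are units, and a homomorphism out of a group that kills the kernel of a
surjection descends). [claim: Mochizuki2012, status: disputed] -/
theorem exists_factor_of_ker_le (n : ℕ) (hker : S.proj.ker ≤ S.incl.range)
    (hkill : ∀ b : S.AutBar, S.ρ n (S.incl b) = 1) :
    ∃ ρbar : S.GE →* AddMonoid.End (S.Tor n), ∀ a : S.AutK, S.ρ n a = ρbar ⟨S.proj a, ⟨a, rfl⟩⟩ := by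
  classical
  -- `ρ_n` with values in the units of `End(E[n])`
  let ρu : S.AutK →* (AddMonoid.End (S.Tor n))ˣ := (S.ρ n).toHomUnits
  -- the surjection `Aut_k(E_k̄) ↠ G_E`
  let f : S.AutK →* S.GE := S.proj.rangeRestrict
  have hf : Function.Surjective f := S.proj.rangeRestrict_surjective
  have hkerle : f.ker ≤ ρu.ker := by
    intro a ha
    have ha' : a ∈ S.proj.ker := by
      rw [MonoidHom.mem_ker] at ha ⊢
      exact congrArg Subtype.val ha
    obtain ⟨b, rfl⟩ := hker ha'
    rw [MonoidHom.mem_ker]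
    ext1
    simp [ρu, hkill b]
  refine ⟨(Units.coeHom _).comp (f.liftOfSurjective hf ⟨ρu, hkerle⟩), fun a => ?_⟩
  have h1 : (f.liftOfSurjective hf ⟨ρu, hkerle⟩) (f a) = ρu a :=
    f.liftOfRightInverse_comp_apply _ _ ⟨ρu, hkerle⟩ a
  have h2 : (⟨S.proj a, ⟨a, rfl⟩⟩ : S.GE) = f a := rfl
  rw [h2, MonoidHom.comp_apply, h1]
  rfl

/-- Conversely: if `ρ_n` factors through `G_E` and `Aut_k̄(E_k̄) ⊆ Ker(Aut_k(E_k̄) → G_k)` (the other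
half of exactness in (ii)), then `ρ_n` kills `Aut_k̄(E_k̄)`. [claim: Mochizuki2012, status: disputed] -/
theorem rho_incl_eq_one_of_exists_factor (n : ℕ) (hle : S.incl.range ≤ S.proj.ker)
    (h : ∃ ρbar : S.GE →* AddMonoid.End (S.Tor n), ∀ a : S.AutK, S.ρ n a = ρbar ⟨S.proj a, ⟨a, rfl⟩⟩)
    (b : S.AutBar) : S.ρ n (S.incl b) = 1 := by
  obtain ⟨ρbar, hρ⟩ := h
  have hb : S.proj (S.incl b) = 1 := MonoidHom.mem_ker.mp (hle ⟨b, rfl⟩)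
  have h1 : (⟨S.proj (S.incl b), ⟨S.incl b, rfl⟩⟩ : S.GE) = 1 := Subtype.ext hb
  rw [hρ (S.incl b), h1, map_one]

/-- **[IUTchIV] Prop. 1.8 (iii) over the interface** (printed proof p. 20: "`Aut_k̄(E_k̄) = {±1}` acts
trivially on `E_k̄[2]`"): if `Ker(Aut_k(E_k̄) → G_k) ⊆ Aut_k̄(E_k̄)` and `ρ₂` kills `Aut_k̄(E_k̄)`, then
`ρ₂` factors through `G_E` — i.e. `S.P18_iii` holds (its hypothesis `#Aut_k̄(E_k̄) = 2` is not even
needed at this level; the real-form input is that `{±1}` acts trivially on the `2`-torsion).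
[claim: Mochizuki2012, status: disputed] -/
theorem p18_iii_of_ker_le_range (hker : S.proj.ker ≤ S.incl.range)
    (hkill : ∀ b : S.AutBar, S.ρ 2 (S.incl b) = 1) : S.P18_iii :=
  fun _ => S.exists_factor_of_ker_le 2 hker hkill

/-- **[IUTchIV] Prop. 1.8 (iii) from (ii)** and the triviality of `Aut_k̄(E_k̄)` on `E_k̄[2]`.
[claim: Mochizuki2012, status: disputed] -/
theorem p18_iii_of_p18_ii (hii : S.P18_ii) (hkill : ∀ b : S.AutBar, S.ρ 2 (S.incl b) = 1) :
    S.P18_iii :=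
  S.p18_iii_of_ker_le_range (le_of_eq hii.2.1.symm) hkill

/-- Under the exactness `Im(incl) = Ker(proj)` of (ii), the CONCLUSION of (iii) ("`ρ₂` factors through
`G_E`") is equivalent to "`Aut_k̄(E_k̄)` acts trivially on `E_k̄[2]`" — the hypothesis of
`p18_iii_of_ker_le_range` is exactly the residual content of (iii). [claim: Mochizuki2012, status: disputed] -/
theorem p18_iii_conclusion_iff (hexact : S.incl.range = S.proj.ker) :
    (∃ ρbar : S.GE →* AddMonoid.End (S.Tor 2), ∀ a : S.AutK, S.ρ 2 a = ρbar ⟨S.proj a, ⟨a, rfl⟩⟩) ↔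
      ∀ b : S.AutBar, S.ρ 2 (S.incl b) = 1 :=
  ⟨fun h b => S.rho_incl_eq_one_of_exists_factor 2 hexact.le h b,
    fun h => S.exists_factor_of_ker_le 2 hexact.ge h⟩

end TorsionSetting

end Prop18

end Literature.IUT.LogVolume
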